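import Summits.CriticalPhenomena.CardyFormulaZ2.Theorems.CardyBoundaryCoulombGasRectilinearCardyStubRowBlocksPart2
import HarnessLib

/-!
# Stub B `stub_rowBlocks` of line `excursion-kernel-covariance`, part 4: the run of the boundary
# cycle through a flat zone
# (crux `RectilinearCardy`, stmt-CriticalPhenomena-5660, route `CardyBoundaryCoulombGas`)

For the lattice polygon `V = {x : δ x ∈ D̄}` of a Jordan domain `D` and ONE enumeration `e` of its
exterior darts by the counter-clockwise walk (`e (n + 1) = dsucc V (e n)`, period `P`, no repetition
below `P`, every exterior dart enumerated — the output of the BOUNDARY FEET stub), inside a ball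
`B(c, r)` on which `D̄` is the half-plane `{nrmC o ≥ h}`:

* lattice points with prescribed frame coordinates (`rb_exists_site`, `rb_site_eq`) and frame
  coordinates of integer marches `x + j • dir (k₀ + 1)` (`rb_zsmul_coords`);
* `rb_march_fwd`, `rb_march_bwd` — from an anchor dart `e iZ = (xZ, k₀)` on the row, the cycle
  marches straight forward `e (iZ + j) = (xZ + j • dir (k₀ + 1), k₀)` and straight backward
  `e (iZ + P - j) = (xZ + j • dir (k₀ + 3), k₀)` while inside the ball;
* `rb_zone_mark` — **the run through the zone of a mark**: if the origin dart `e 0` is far from `c`,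
  the anchor row dart with prescribed tangential coordinate `kZ` (`|δ kZ - tngC c| < δ`) sits at an
  index `iZ` with `n < iZ`, `iZ + n < P`, and every dart of the cycle whose vertex is within `r/4` of
  `c` is a row dart at index `iZ + j` with tangential coordinate `kZ + j s`, `|j| ≤ n` (the window
  zone about the origin dart itself is treated in part 5).

All [folklore].
-/

noncomputable section

open Set Metric
open Literature.Probability.RandomPlanarGeometry
open Literature.Probability.LatticeModels (Site meshPoint Orient)
open Literature.Probability.LatticeModels.CollarLegModel (Dart dartTip dir dsucc outDart period neighbours)
open Summit.CriticalPhenomena.CardyFormulaZ2.Cruxes.BoundaryDefectGaussianR.RainbowMonomialsInExcursionKernels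
  (s3_dsucc_injective tp_dir_add_three)

namespace Summit.CriticalPhenomena.CardyFormulaZ2.Cruxes.RectilinearCardy.ExcursionKernelCovariance

/-! ### Frame coordinates on `ℤ × ℤ` -/

/-- A lattice point with prescribed tangential and normal coordinates. [folklore] -/
theorem rb_exists_site (o : Orient) (t n : ℤ) :
    ∃ x : ℤ × ℤ, Orient.tng o (![x.1, x.2] : Site 2) = t ∧ Orient.nrm o (![x.1, x.2] : Site 2) = n := by
  cases o
  · exact ⟨(t, n), rfl, rfl⟩
  · exact ⟨(t, -n), rfl, by simp [Orient.nrm]⟩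
  · exact ⟨(n, t), rfl, rfl⟩
  · exact ⟨(-n, t), rfl, by simp [Orient.nrm]⟩

/-- Frame coordinates determine the lattice point. [folklore] -/
theorem rb_site_eq (o : Orient) {x y : ℤ × ℤ}
    (ht : Orient.tng o (![x.1, x.2] : Site 2) = Orient.tng o (![y.1, y.2] : Site 2))
    (hn : Orient.nrm o (![x.1, x.2] : Site 2) = Orient.nrm o (![y.1, y.2] : Site 2)) : x = y := by
  cases o <;> simp [Orient.tng, Orient.nrm] at ht hn <;> exact Prod.ext (by omega) (by omega)

/-- Frame coordinates of an integer march along the walk direction: the normal coordinate is kept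
and the tangential one moves by `j s`. [folklore] -/
theorem rb_zsmul_coords {o : Orient} {k₀ : Fin 4} {s : ℤ}
    (htab : ∀ x : ℤ × ℤ,
      Orient.nrm o (![(x + dir k₀).1, (x + dir k₀).2] : Site 2) = Orient.nrm o (![x.1, x.2] : Site 2) - 1 ∧
      Orient.nrm o (![(x + dir (k₀ + 1)).1, (x + dir (k₀ + 1)).2] : Site 2) = Orient.nrm o (![x.1, x.2] : Site 2) ∧
      Orient.nrm o (![(x + dir (k₀ + 2)).1, (x + dir (k₀ + 2)).2] : Site 2) = Orient.nrm o (![x.1, x.2] : Site 2) + 1 ∧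
      Orient.nrm o (![(x + dir (k₀ + 3)).1, (x + dir (k₀ + 3)).2] : Site 2) = Orient.nrm o (![x.1, x.2] : Site 2) ∧
      Orient.tng o (![(x + dir (k₀ + 1)).1, (x + dir (k₀ + 1)).2] : Site 2) = Orient.tng o (![x.1, x.2] : Site 2) + s ∧
      Orient.tng o (![(x + dir (k₀ + 3)).1, (x + dir (k₀ + 3)).2] : Site 2) = Orient.tng o (![x.1, x.2] : Site 2) - s)
    (x : ℤ × ℤ) (j : ℤ) :
    Orient.nrm o (![(x + j • dir (k₀ + 1)).1, (x + j • dir (k₀ + 1)).2] : Site 2) = Orient.nrm o (![x.1, x.2] : Site 2) ∧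
    Orient.tng o (![(x + j • dir (k₀ + 1)).1, (x + j • dir (k₀ + 1)).2] : Site 2) =
      Orient.tng o (![x.1, x.2] : Site 2) + j * s := by
  have h3 : dir (k₀ + 3) = -dir (k₀ + 1) := tp_dir_add_three k₀
  induction j using Int.induction_on with
  | zero => simp
  | succ j ih =>
    rw [add_zsmul, one_zsmul, ← add_assoc, (htab _).2.1, (htab _).2.2.2.2.1, ih.1, ih.2]
    exact ⟨rfl, by ring⟩
  | pred j ih =>
    rw [sub_zsmul, one_zsmul, sub_eq_add_neg, ← h3, ← add_assoc, (htab _).2.2.2.1, (htab _).2.2.2.2.2, ih.1,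
      ih.2]
    exact ⟨rfl, by ring⟩

/-- Natural marches are integer marches. [folklore] -/
theorem rb_nsmul_eq_zsmul (x w : ℤ × ℤ) (j : ℕ) : x + j • w = x + (j : ℤ) • w := by
  rw [natCast_zsmul]

/-- Backward natural marches are integer marches: `x + j • dir (k₀ + 3) = x + (-j) • dir (k₀ + 1)`.
[folklore] -/
theorem rb_nsmul_back (x : ℤ × ℤ) (k₀ : Fin 4) (j : ℕ) :
    x + j • dir (k₀ + 3) = x + (-(j : ℤ)) • dir (k₀ + 1) := by
  have h3 : dir (k₀ + 3) = -dir (k₀ + 1) := tp_dir_add_three k₀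
  rw [h3, neg_zsmul, ← natCast_zsmul, zsmul_neg]

/-! ### Marching from an anchor dart -/

section March

variable {D : JordanDomain} {δ : ℝ} {V : Finset (ℤ × ℤ)} {e : ℕ → Dart} {P : ℕ} {o : Orient} {h r : ℝ}
  {c : ℂ} {k₀ : Fin 4} {s : ℤ}

/-- **Forward march.** From an anchor row dart `e iZ = (xZ, k₀)` the cycle marches straight:
`e (iZ + j) = (xZ + j • dir (k₀ + 1), k₀)` for `j ≤ n`, as long as it stays inside the ball. [folklore] -/
theorem rb_march_fwd (hδ : 0 < δ)
    (hV : ∀ x : ℤ × ℤ, x ∈ V ↔ meshPoint δ (![x.1, x.2] : Site 2) ∈ closure D.carrier)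
    (hsucc : ∀ n, e (n + 1) = dsucc V (e n))
    (hcl : ∀ z, dist z c < r → (z ∈ closure D.carrier ↔ h ≤ Orient.nrmC o z))
    (hk₀ : ∀ (x : ℤ × ℤ) (k : Fin 4),
      Orient.nrm o (![x.1, x.2] : Site 2) - 1 ≤ Orient.nrm o (![(x + dir k).1, (x + dir k).2] : Site 2) ∧
      (Orient.nrm o (![(x + dir k).1, (x + dir k).2] : Site 2) = Orient.nrm o (![x.1, x.2] : Site 2) - 1 ↔ k = k₀))
    (hk₁ : ∀ x : ℤ × ℤ,
      Orient.nrm o (![(x + dir (k₀ + 1)).1, (x + dir (k₀ + 1)).2] : Site 2) = Orient.nrm o (![x.1, x.2] : Site 2))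
    {iZ : ℕ} {xZ : ℤ × ℤ} (hiZ : e iZ = (xZ, k₀)) (hrow : Orient.nrm o (![xZ.1, xZ.2] : Site 2) = ⌈h / δ⌉)
    {n : ℕ} (hn : dist (meshPoint δ (![xZ.1, xZ.2] : Site 2)) c + (n + 2) * δ < r) :
    ∀ j ≤ n, e (iZ + j) = (xZ + j • dir (k₀ + 1), k₀) := by
  intro j hj
  rw [← rb_iterate_eq hsucc j iZ, hiZ]
  exact (rb_iterate_row hV hδ hcl hk₀ hk₁ hrow hn j hj).1

/-- **Backward march.** From an anchor row dart `e iZ = (xZ, k₀)` the cycle, read backwards,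
marches straight the other way: `e (iZ + P - j) = (xZ + j • dir (k₀ + 3), k₀)` for `j ≤ n < P`
(injectivity of `dsucc` on exterior darts). [folklore] -/
theorem rb_march_bwd (hδ : 0 < δ)
    (hV : ∀ x : ℤ × ℤ, x ∈ V ↔ meshPoint δ (![x.1, x.2] : Site 2) ∈ closure D.carrier)
    (hsucc : ∀ n, e (n + 1) = dsucc V (e n)) (hper : ∀ n, e (n + P) = e n)
    (hext : ∀ n, (e n).1 ∈ V ∧ dartTip (e n) ∉ V)
    (hcl : ∀ z, dist z c < r → (z ∈ closure D.carrier ↔ h ≤ Orient.nrmC o z))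
    (htab : ∀ x : ℤ × ℤ,
      Orient.nrm o (![(x + dir k₀).1, (x + dir k₀).2] : Site 2) = Orient.nrm o (![x.1, x.2] : Site 2) - 1 ∧
      Orient.nrm o (![(x + dir (k₀ + 1)).1, (x + dir (k₀ + 1)).2] : Site 2) = Orient.nrm o (![x.1, x.2] : Site 2) ∧
      Orient.nrm o (![(x + dir (k₀ + 2)).1, (x + dir (k₀ + 2)).2] : Site 2) = Orient.nrm o (![x.1, x.2] : Site 2) + 1 ∧
      Orient.nrm o (![(x + dir (k₀ + 3)).1, (x + dir (k₀ + 3)).2] : Site 2) = Orient.nrm o (![x.1, x.2] : Site 2) ∧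
      Orient.tng o (![(x + dir (k₀ + 1)).1, (x + dir (k₀ + 1)).2] : Site 2) = Orient.tng o (![x.1, x.2] : Site 2) + s ∧
      Orient.tng o (![(x + dir (k₀ + 3)).1, (x + dir (k₀ + 3)).2] : Site 2) = Orient.tng o (![x.1, x.2] : Site 2) - s)
    (hk₀ : ∀ (x : ℤ × ℤ) (k : Fin 4),
      Orient.nrm o (![x.1, x.2] : Site 2) - 1 ≤ Orient.nrm o (![(x + dir k).1, (x + dir k).2] : Site 2) ∧
      (Orient.nrm o (![(x + dir k).1, (x + dir k).2] : Site 2) = Orient.nrm o (![x.1, x.2] : Site 2) - 1 ↔ k = k₀))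
    {iZ : ℕ} {xZ : ℤ × ℤ} (hiZ : e iZ = (xZ, k₀)) (hrow : Orient.nrm o (![xZ.1, xZ.2] : Site 2) = ⌈h / δ⌉)
    {n : ℕ} (hn : dist (meshPoint δ (![xZ.1, xZ.2] : Site 2)) c + (n + 2) * δ < r) (hnP : n < P) :
    ∀ j ≤ n, e (iZ + P - j) = (xZ + j • dir (k₀ + 3), k₀) := by
  have h3 : dir (k₀ + 3) = -dir (k₀ + 1) := tp_dir_add_three k₀
  have hk₁ : ∀ x : ℤ × ℤ, Orient.nrm o (![(x + dir (k₀ + 1)).1, (x + dir (k₀ + 1)).2] : Site 2) =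
      Orient.nrm o (![x.1, x.2] : Site 2) := fun x => (htab x).2.1
  -- the backward march stays on the row and inside the ball
  have hrowj : ∀ j : ℕ, Orient.nrm o (![(xZ + j • dir (k₀ + 3)).1, (xZ + j • dir (k₀ + 3)).2] : Site 2) = ⌈h / δ⌉ := by
    intro j
    rw [rb_nsmul_back, (rb_zsmul_coords htab xZ _).1, hrow]
  have hdistj : ∀ j ≤ n, dist (meshPoint δ (![(xZ + j • dir (k₀ + 3)).1, (xZ + j • dir (k₀ + 3)).2] : Site 2)) c +
      2 * δ < r := by
    intro j hj
    have h1 := rb_dist_mesh_nsmul_le hδ xZ (k₀ + 3) j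
    have h2 : (j : ℝ) ≤ n := by exact_mod_cast hj
    have h3 := dist_triangle (meshPoint δ (![(xZ + j • dir (k₀ + 3)).1, (xZ + j • dir (k₀ + 3)).2] : Site 2))
      (meshPoint δ (![xZ.1, xZ.2] : Site 2)) c
    nlinarith [hδ.le]
  intro j hj
  induction j with
  | zero => simpa [hper] using hiZ
  | succ j ih =>
    have ih' := ih (Nat.le_of_succ_le hj)
    set y : ℤ × ℤ := xZ + (j + 1) • dir (k₀ + 3) with hy
    obtain ⟨hyV, hyout, -⟩ := rb_row_vertex hV hδ hcl hk₀ (by have := hdistj (j + 1) hj; linarith) (hrowj (j + 1))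
    have hds : dsucc V (y, k₀) = (xZ + j • dir (k₀ + 3), k₀) := by
      rw [rb_dsucc_row hV hδ hcl hk₀ hk₁ (hdistj (j + 1) hj) (hrowj (j + 1))]
      refine Prod.ext ?_ rfl
      show xZ + (j + 1) • dir (k₀ + 3) + dir (k₀ + 1) = xZ + j • dir (k₀ + 3)
      rw [succ_nsmul, h3]
      abel
    have hidx : iZ + P - (j + 1) + 1 = iZ + P - j := by omega
    have hd : dsucc V (e (iZ + P - (j + 1))) = dsucc V (y, k₀) := by rw [← hsucc, hidx, ih', hds]
    exact s3_dsucc_injective V _ _ (hext _).1 (hext _).2 hyV hyout hd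

end March

/-! ### The run through a zone -/

section Zone

variable {D : JordanDomain} {δ : ℝ} {V : Finset (ℤ × ℤ)} {e : ℕ → Dart} {P : ℕ} {o : Orient} {h r : ℝ}
  {c : ℂ} {k₀ : Fin 4} {s : ℤ}

/-- **The run of the boundary cycle through the zone of a mark.** Inside `B(c, r)` let `D̄` be the
half-plane `{nrmC o ≥ h}` with `nrmC c = h`, `40 δ ≤ r`, and let the origin dart `e 0` sit at distance
`≥ r/2` from `c`. For an integer `kZ` with `|δ kZ - tngC c| < δ` there are an anchor row vertex `xZ`
(tangential coordinate `kZ`, within `2δ` of `c`) and an index `iZ` with `e iZ = (xZ, k₀)`,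
`n < iZ`, `iZ + n < P` for `n = ⌊r / (4δ)⌋₊ + 3`, the forward march `e (iZ + j) = (xZ + j • dir (k₀ + 1), k₀)`
(`j ≤ n`), and: every dart `e i`, `i < P`, whose vertex is within `r/4` of `c` is a row dart
(`nrm = ⌈h/δ⌉`, neighbour count one, direction `k₀`) at index `i = iZ + j` with tangential coordinate
`kZ + j s` for an integer `|j| ≤ n`. [folklore] -/
theorem rb_zone_mark (hδ : 0 < δ)
    (hV : ∀ x : ℤ × ℤ, x ∈ V ↔ meshPoint δ (![x.1, x.2] : Site 2) ∈ closure D.carrier)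
    (hsucc : ∀ n, e (n + 1) = dsucc V (e n)) (hper : ∀ n, e (n + P) = e n)
    (hext : ∀ n, (e n).1 ∈ V ∧ dartTip (e n) ∉ V)
    (henum : ∀ d : Dart, d.1 ∈ V → dartTip d ∉ V → ∃ n, n < P ∧ e n = d)
    (hnodup : ∀ n m, n < P → m < P → e n = e m → n = m)
    (hc : Orient.nrmC o c = h) (hcl : ∀ z, dist z c < r → (z ∈ closure D.carrier ↔ h ≤ Orient.nrmC o z))
    (htab : ∀ x : ℤ × ℤ,
      Orient.nrm o (![(x + dir k₀).1, (x + dir k₀).2] : Site 2) = Orient.nrm o (![x.1, x.2] : Site 2) - 1 ∧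
      Orient.nrm o (![(x + dir (k₀ + 1)).1, (x + dir (k₀ + 1)).2] : Site 2) = Orient.nrm o (![x.1, x.2] : Site 2) ∧
      Orient.nrm o (![(x + dir (k₀ + 2)).1, (x + dir (k₀ + 2)).2] : Site 2) = Orient.nrm o (![x.1, x.2] : Site 2) + 1 ∧
      Orient.nrm o (![(x + dir (k₀ + 3)).1, (x + dir (k₀ + 3)).2] : Site 2) = Orient.nrm o (![x.1, x.2] : Site 2) ∧
      Orient.tng o (![(x + dir (k₀ + 1)).1, (x + dir (k₀ + 1)).2] : Site 2) = Orient.tng o (![x.1, x.2] : Site 2) + s ∧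
      Orient.tng o (![(x + dir (k₀ + 3)).1, (x + dir (k₀ + 3)).2] : Site 2) = Orient.tng o (![x.1, x.2] : Site 2) - s)
    (hk₀ : ∀ (x : ℤ × ℤ) (k : Fin 4),
      Orient.nrm o (![x.1, x.2] : Site 2) - 1 ≤ Orient.nrm o (![(x + dir k).1, (x + dir k).2] : Site 2) ∧
      (Orient.nrm o (![(x + dir k).1, (x + dir k).2] : Site 2) = Orient.nrm o (![x.1, x.2] : Site 2) - 1 ↔ k = k₀))
    (hs : s = 1 ∨ s = -1) (hrδ : 40 * δ ≤ r)
    (hfar : r / 2 ≤ dist (meshPoint δ (![(e 0).1.1, (e 0).1.2] : Site 2)) c)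
    {kZ : ℤ} (hkZ : |δ * kZ - Orient.tngC o c| < δ) :
    ∃ (xZ : ℤ × ℤ) (iZ : ℕ), Orient.tng o (![xZ.1, xZ.2] : Site 2) = kZ ∧
      Orient.nrm o (![xZ.1, xZ.2] : Site 2) = ⌈h / δ⌉ ∧ dist (meshPoint δ (![xZ.1, xZ.2] : Site 2)) c < 2 * δ ∧
      e iZ = (xZ, k₀) ∧ ⌊r / (4 * δ)⌋₊ + 3 < iZ ∧ iZ + (⌊r / (4 * δ)⌋₊ + 3) < P ∧
      (∀ j ≤ ⌊r / (4 * δ)⌋₊ + 3, e (iZ + j) = (xZ + j • dir (k₀ + 1), k₀)) ∧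
      ∀ i < P, dist (meshPoint δ (![(e i).1.1, (e i).1.2] : Site 2)) c < r / 4 →
        Orient.nrm o (![(e i).1.1, (e i).1.2] : Site 2) = ⌈h / δ⌉ ∧ (e i).2 = k₀ ∧
        ((neighbours (e i).1).filter (fun y ↦ y ∉ V)).card = 1 ∧
        ∃ j : ℤ, |j| ≤ (⌊r / (4 * δ)⌋₊ + 3 : ℕ) ∧ (i : ℤ) = iZ + j ∧
          Orient.tng o (![(e i).1.1, (e i).1.2] : Site 2) = kZ + j * s := by
  set n : ℕ := ⌊r / (4 * δ)⌋₊ + 3 with hn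
  set M : ℤ := ⌈h / δ⌉ with hM
  have hr : 0 < r := by linarith
  -- the anchor
  obtain ⟨xZ, hxt, hxn⟩ := rb_exists_site o kZ M
  obtain ⟨hm1, hm2⟩ := kwl_ceil_bounds (h := h) hδ
  have hxdist : dist (meshPoint δ (![xZ.1, xZ.2] : Site 2)) c < 2 * δ := by
    have h1 := Orient.norm_le_abs_tngC_add_abs_nrmC o (meshPoint δ (![xZ.1, xZ.2] : Site 2) - c)
    rw [Orient.tngC_sub, Orient.nrmC_sub, Orient.tngC_meshPoint, Orient.nrmC_meshPoint, hxt, hxn, hc] at h1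
    rw [dist_eq_norm]
    have h2 : |δ * (M : ℝ) - h| < δ := by rw [abs_lt]; constructor <;> linarith
    have h3 : |δ * ((kZ : ℤ) : ℝ) - Orient.tngC o c| < δ := hkZ
    linarith
  -- size of the run
  have hnδ : (n : ℝ) * δ ≤ r / 4 + 3 * δ := by
    have h1 : (⌊r / (4 * δ)⌋₊ : ℝ) ≤ r / (4 * δ) := Nat.floor_le (by positivity)
    have h2 : (n : ℝ) = ⌊r / (4 * δ)⌋₊ + 3 := by rw [hn]; push_cast; ring
    rw [h2, add_mul]
    have h3 : (⌊r / (4 * δ)⌋₊ : ℝ) * δ ≤ r / (4 * δ) * δ := mul_le_mul_of_nonneg_right h1 hδ.le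
    rw [div_mul_eq_mul_div, mul_div_mul_right _ _ hδ.ne'] at h3
    linarith
  have hnlt : r / (4 * δ) < (n : ℝ) - 2 := by
    have h1 := Nat.lt_floor_add_one (r / (4 * δ))
    have h2 : (n : ℝ) = ⌊r / (4 * δ)⌋₊ + 3 := by rw [hn]; push_cast; ring
    linarith
  have hrun : dist (meshPoint δ (![xZ.1, xZ.2] : Site 2)) c + (n + 2) * δ < r := by nlinarith
  -- the anchor dart is enumerated
  have hk₁ : ∀ x : ℤ × ℤ, Orient.nrm o (![(x + dir (k₀ + 1)).1, (x + dir (k₀ + 1)).2] : Site 2) =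
      Orient.nrm o (![x.1, x.2] : Site 2) := fun x => (htab x).2.1
  obtain ⟨hxV, hxout, -⟩ := rb_row_vertex hV hδ hcl hk₀ (by linarith) hxn
  obtain ⟨iZ, hiZP, hiZ⟩ := henum (xZ, k₀) hxV hxout
  have hfwd := rb_march_fwd hδ hV hsucc hcl hk₀ hk₁ hiZ hxn hrun
  -- no wrap forward: the origin is far
  have hfar' : ∀ (j : ℕ) (w : ℤ × ℤ), j ≤ n → (e 0).1 = xZ + j • w → (w = dir (k₀ + 1) ∨ w = dir (k₀ + 3)) → False := by
    intro j w hj h0 hw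
    have h1 : dist (meshPoint δ (![(xZ + j • w).1, (xZ + j • w).2] : Site 2)) (meshPoint δ (![xZ.1, xZ.2] : Site 2)) ≤
        j * δ := by rcases hw with rfl | rfl <;> exact rb_dist_mesh_nsmul_le hδ xZ _ j
    have h2 := dist_triangle (meshPoint δ (![(xZ + j • w).1, (xZ + j • w).2] : Site 2))
      (meshPoint δ (![xZ.1, xZ.2] : Site 2)) c
    rw [← h0] at h1 h2
    have h3 : (j : ℝ) * δ ≤ n * δ := mul_le_mul_of_nonneg_right (by exact_mod_cast hj) hδ.le
    linarith
  have hiZn : iZ + n < P := by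
    by_contra hge
    rw [not_lt] at hge
    have hj : P - iZ ≤ n := by omega
    have h1 := hfwd (P - iZ) hj
    rw [show iZ + (P - iZ) = 0 + P by omega, hper] at h1
    exact hfar' (P - iZ) _ hj (by rw [h1]) (Or.inl rfl)
  have hnP : n < P := by omega
  have hbwd := rb_march_bwd hδ hV hsucc hper hext hcl htab hk₀ hiZ hxn hrun hnP
  have hniZ : n < iZ := by
    by_contra hge
    rw [not_lt] at hge
    have h1 := hbwd iZ hge
    rw [show iZ + P - iZ = 0 + P by omega, hper] at h1
    exact hfar' iZ _ hge (by rw [h1]) (Or.inr rfl)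
  refine ⟨xZ, iZ, hxt, hxn, hxdist, hiZ, hniZ, hiZn, hfwd, fun i hi hid => ?_⟩
  -- capture of a dart near `c`
  have hid' : dist (meshPoint δ (![(e i).1.1, (e i).1.2] : Site 2)) c + δ < r := by linarith
  have htip : (e i).1 + dir (e i).2 ∉ V := (hext i).2
  obtain ⟨hrow, hdir⟩ := rb_ext_dart_row hV hδ hcl hk₀ hid' (hext i).1 htip
  obtain ⟨-, -, -, hcard, -⟩ := rb_row_vertex hV hδ hcl hk₀ hid' hrow
  refine ⟨hrow, hdir, hcard, ?_⟩
  -- the tangential offset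
  set d : ℤ := Orient.tng o (![(e i).1.1, (e i).1.2] : Site 2) - kZ with hd
  have hdabs : |(d : ℝ)| * δ < r / 4 + 2 * δ := by
    have h1 : |Orient.tngC o (meshPoint δ (![(e i).1.1, (e i).1.2] : Site 2)) -
        Orient.tngC o (meshPoint δ (![xZ.1, xZ.2] : Site 2))| ≤
        dist (meshPoint δ (![(e i).1.1, (e i).1.2] : Site 2)) (meshPoint δ (![xZ.1, xZ.2] : Site 2)) := by
      rw [← Orient.tngC_sub, dist_eq_norm]; exact Orient.abs_tngC_le_norm o _
    rw [Orient.tngC_meshPoint, Orient.tngC_meshPoint, hxt, ← mul_sub, abs_mul, abs_of_pos hδ] at h1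
    have h2 := dist_triangle (meshPoint δ (![(e i).1.1, (e i).1.2] : Site 2)) c (meshPoint δ (![xZ.1, xZ.2] : Site 2))
    rw [dist_comm c] at h2
    have h3 : ((Orient.tng o (![(e i).1.1, (e i).1.2] : Site 2) : ℤ) : ℝ) - ((kZ : ℤ) : ℝ) = (d : ℝ) := by
      rw [hd]; push_cast; ring
    rw [h3] at h1
    nlinarith [abs_nonneg (d : ℝ)]
  have hdn : |d| ≤ n := by
    have h1 : |(d : ℝ)| < n := by
      by_contra hge
      rw [not_lt] at hge
      have := mul_le_mul_of_nonneg_right hge hδ.le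
      have h4 : r / (4 * δ) * δ = r / 4 := by field_simp
      nlinarith
    have h2 : |d| < (n : ℤ) := by exact_mod_cast h1
    exact h2.le
  set j : ℤ := d * s with hj
  have hs2 : s * s = 1 := by rcases hs with rfl | rfl <;> norm_num
  have hjabs : |j| = |d| := by rw [hj, abs_mul]; rcases hs with rfl | rfl <;> simp
  have hdj : d = j * s := by rw [hj, mul_assoc, hs2, mul_one]
  refine ⟨j, by rw [hjabs]; exact_mod_cast hdn, ?_, by rw [← hdj, hd]; ring⟩
  -- the vertex is the marched point, and the index follows from no repetition
  have hvert : (e i).1 = xZ + j • dir (k₀ + 1) := by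
    apply rb_site_eq o
    · rw [(rb_zsmul_coords htab xZ j).2, hxt, ← hdj, hd]; ring
    · rw [(rb_zsmul_coords htab xZ j).1, hxn, hrow]
  have hei : e i = (xZ + j • dir (k₀ + 1), k₀) := Prod.ext hvert hdir
  rcases le_or_gt 0 j with hj0 | hj0
  · have hjn : j.toNat ≤ n := by
      have : (j.toNat : ℤ) ≤ n := by rw [Int.toNat_of_nonneg hj0]; exact (le_abs_self j).trans (hjabs ▸ hdn)
      exact_mod_cast this
    have h1 := hfwd j.toNat hjn
    rw [rb_nsmul_eq_zsmul, Int.natCast_toNat_eq_self.2 hj0, ← hei] at h1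
    have := hnodup _ _ (by omega) hi h1
    rw [← this]; push_cast; rw [Int.toNat_of_nonneg hj0]
  · have hjn : (-j).toNat ≤ n := by
      have : ((-j).toNat : ℤ) ≤ n := by
        rw [Int.toNat_of_nonneg (by omega)]; exact (neg_le_abs j).trans (hjabs ▸ hdn)
      exact_mod_cast this
    have h1 := hbwd (-j).toNat hjn
    rw [rb_nsmul_back, Int.natCast_toNat_eq_self.2 (by omega), neg_neg, ← hei] at h1
    have hlt : (-j).toNat < iZ := lt_of_le_of_lt hjn hniZ
    rw [show iZ + P - (-j).toNat = (iZ - (-j).toNat) + P by omega, hper] at h1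
    have := hnodup _ _ (by omega) hi h1
    rw [← this]
    have h2 : ((iZ - (-j).toNat : ℕ) : ℤ) = iZ - (-j).toNat := by push_cast [hlt.le]; ring
    rw [h2, Int.toNat_of_nonneg (by omega)]; ring

end Zone

end Summit.CriticalPhenomena.CardyFormulaZ2.Cruxes.RectilinearCardy.ExcursionKernelCovariance

end
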